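import Summits.AtomisticToContinuum.HydrodynamicLimit.Theorems.LocalSecondLaw.Negative.RAfterN

/-!
# `LocalSecondLaw` with `N₀` uniform in the mollification radius is FALSE

Negative knowledge for the crux `JParityClosure.LocalSecondLaw` (stmt-AtomisticToContinuum-13081), cycle 2 of
the standing disprover (`Cruxes/LocalSecondLaw/Disproof.lean` §(c'')).  `LocalSecondLawUniformN` is the crux
VERBATIM except that the threshold `N₀` is chosen BEFORE the radius `r`:
`∃ r₀ > 0, ∃ N₀, ∀ r ∈ (0, r₀), ∀ N ≥ N₀` instead of the filed `∃ r₀ > 0, ∀ r ∈ (0, r₀), ∃ N₀(r), ∀ N ≥ N₀`.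
It is refuted by the singleton-ball degeneracy of `RAfterN.lean` read at the fixed particle number `N₀`: once
`2r < ε_{N₀} = σ (N₀+1)^{-1/3}`, every mollifier ball holds at most one centre, the empirical temperature vanishes,
the guard gives `H ≡ 0`, the space–time functional is `0` surely on `Φ.good` (`entropyFunctional_eq_zero_of_sep`)
and the event is decided by the boundary term, `f_ex(σ³) - 3 ≤ -1 < -1/2` for the hot matched equilibrium
`(1, e², 0)` — probability `1 > 1/2`.  MORAL for provers: `N₀(r) → ∞` as `r → 0` is forced (at least
`N₀(r) ≳ (σ/r)³`, i.e. `ε_{N₀} ≲ r`); together with `not_localSecondLawRAfterN` this pins the admissible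
dependence of the two thresholds: `r` frozen first, then `N r³/σ³ → ∞` centres per ball.
refuter-cdisprove-stmt-AtomisticToContinuum-13081-g2-0.
-/

noncomputable section

namespace Summit.AtomisticToContinuum.HydrodynamicLimit.Theorems.LocalSecondLawNegative

open MeasureTheory Filter Set Topology
open scoped ENNReal
open Literature.MathematicalPhysics.KineticTheory Literature.Analysis.FluidPDE

/-- The crux `LocalSecondLaw` VERBATIM with `∃ N₀` moved BEFORE `∀ r ∈ (0, r₀)` (a particle-number threshold
uniform in the mollification radius). -/
def LocalSecondLawUniformN : Prop :=
  ∀ (a₀ θ₀ : Literature.MathematicalPhysics.KineticTheory.T3 → ℝ) (u₀ : Literature.MathematicalPhysics.KineticTheory.T3 → Literature.MathematicalPhysics.KineticTheory.V3), Continuous a₀ → Continuous θ₀ → Continuous u₀ → (∀ x, 0 < a₀ x) → (∀ x, 0 < θ₀ x) → ∃ σ₀ : ℝ, 0 < σ₀ ∧ ∀ σ : ℝ, 0 < σ → σ < σ₀ → ∀ (T : ℝ) (ρ θ : ℝ → Literature.MathematicalPhysics.KineticTheory.T3 → ℝ) (u : ℝ → Literature.MathematicalPhysics.KineticTheory.T3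 → Literature.MathematicalPhysics.KineticTheory.V3), Literature.MathematicalPhysics.KineticTheory.IsHardSphereEulerSolution σ T ρ u θ → ∀ Φ : (N : ℕ) → Literature.Analysis.FluidPDE.HardSphereFlow (Literature.Analysis.FluidPDE.Torus.geometry (Fin 3)) (Literature.MathematicalPhysics.KineticTheory.hsDiameter σ N) (N + 1), Literature.MathematicalPhysics.KineticTheory.TendstoHydroFieldsAt (fun N => Literature.MathematicalPhysics.KineticTheory.localGibbsLaw σ a₀ u₀ θ₀ N (Φ N)) Φ ρ u θ 0 → 0 < T → ∀ τ : ℝ, 0 < τ → ∀ φ : ℝ → Literature.MathematicalPhysics.KineticTheory.T3 → ℝ, Literature.Analysis.FunctionSpaces.Torus.IsSmoothSpaceTimeOn Set.univ φ → (∀ s x, 0 ≤ φ s x) → (∃ τ' : ℝ, τ' < τ ∧ ∀ s, τ' ≤ s → ∀ x, φ s x = 0) → ∀ η δ : ℝ, 0 < η → 0 < δ → ∃ r₀ : ℝ, 0 < r₀ ∧ ∃ N₀ : ℕ, ∀ r : ℝ, 0 < r → r < r₀ → ∀ N : ℕ, N₀ ≤ N → let γ : Literature.Analysis.FluidPDE.Config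 (N + 1) (Fin 3) Literature.MathematicalPhysics.KineticTheory.T3 → ℝ → Literature.Analysis.FluidPDE.Config (N + 1) (Fin 3) Literature.MathematicalPhysics.KineticTheory.T3 := fun z s => (Φ N).flow s z; let bx : Literature.MathematicalPhysics.KineticTheory.T3 → Literature.MathematicalPhysics.KineticTheory.T3 → ℝ := fun x y => 3 / (Real.pi * r ^ 3) * max (1 - Literature.Analysis.FluidPDE.Torus.euclidDist x y / r) 0; let ρm : Literature.Analysis.FluidPDE.Config (N + 1) (Fin 3) Literature.MathematicalPhysics.KineticTheory.T3 → ℝ → Literature.MathematicalPhysics.KineticTheory.T3 → ℝ := fun z s x₀ => ∫ q, bx q.1 x₀ ∂(Literature.Analysis.FluidPDE.empiricalMeasure (γ z s)); let mm : Literature.Analysis.FluidPDE.Config (N + 1) (Fin 3) Literature.MathematicalPhysics.KineticTheory.T3 → ℝ → Literature.MathematicalPhysics.KineticTheory.T3 → Literature.MathematicalPhysics.KineticTheory.V3 := fun z s x₀ => ∫ q, bx q.1 x₀ • q.2 ∂(Literature.Analysis.FluidPDE.empiricalMeasure (γ z s)); let em : Literature.Analysis.FluidPDE.Config (N + 1)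 (Fin 3) Literature.MathematicalPhysics.KineticTheory.T3 → ℝ → Literature.MathematicalPhysics.KineticTheory.T3 → ℝ := fun z s x₀ => ∫ q, bx q.1 x₀ * (‖q.2‖ ^ 2 / 2) ∂(Literature.Analysis.FluidPDE.empiricalMeasure (γ z s)); let θm : Literature.Analysis.FluidPDE.Config (N + 1) (Fin 3) Literature.MathematicalPhysics.KineticTheory.T3 → ℝ → Literature.MathematicalPhysics.KineticTheory.T3 → ℝ := fun z s x₀ => 2 / 3 * (em z s x₀ / ρm z s x₀ - ‖mm z s x₀‖ ^ 2 / (2 * ρm z s x₀ ^ 2)); let Hs : ℝ → ℝ → ℝ := fun a b => if 0 < a ∧ 0 < b then -(a * (3 / 2 * Real.log b - Real.log a - Literature.MathematicalPhysics.KineticTheory.hsExcessFreeEnergy (a * σ ^ 3))) else 0; let I : Literature.Analysis.FluidPDE.Config (N + 1) (Fin 3) Literature.MathematicalPhysics.KineticTheory.T3 → ℝ := fun z => ∫ s in Set.Icc (0 : ℝ) τ, ∫ x : Literature.MathematicalPhysics.KineticTheory.T3, Hs (ρm z s x) (θm z s x) * (deriv (fun s' => φ s' x) s + ∑ k : Fin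 3, (mm z s x) k / ρm z s x * Literature.Analysis.FunctionSpaces.Torus.partialDeriv k (φ s) x); Literature.MathematicalPhysics.KineticTheory.localGibbsLaw σ a₀ u₀ θ₀ N (Φ N) {z | I z + ∫ x : Literature.MathematicalPhysics.KineticTheory.T3, Hs (ρ 0 x) (θ 0 x) * φ 0 x < -η} ≤ ENNReal.ofReal δ

/-- **`LocalSecondLaw` with `N₀` uniform in `r` is FALSE.**  Witness: homogeneous hot local Gibbs data
`(a₀, θ₀, u₀) = (1, e², 0)`, the matched constant Euler state `(1, 0, e²)` (identified `t = 0` LLN,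
`homogeneous_lln_identified`), Alexander's flows, `φ(s, x) = ψ(s)` (`psi`), `τ = T = 1`, `η = δ = 1/2`; given the
claimed `r₀, N₀` take `N = N₀` and `r = min (r₀/2) (ε_{N₀}/4)`: the functional vanishes on `Φ.good`
(`entropyFunctional_eq_zero_of_sep`) and the boundary term is `f_ex(σ³) - 3 ≤ -1` (`hsExcessFreeEnergy_le_two`),
so the event has probability `1 > 1/2`. [folklore] -/
theorem not_localSecondLawUniformN : ¬ LocalSecondLawUniformN := by
  intro h
  set θ₀ : ℝ := Real.exp 2 with hθ₀
  have hθ₀pos : 0 < θ₀ := Real.exp_pos 2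
  have hc1 : Continuous (fun _ : T3 => (1 : ℝ)) := continuous_const
  have hcθ : Continuous (fun _ : T3 => θ₀) := continuous_const
  have hc0 : Continuous (fun _ : T3 => (0 : V3)) := continuous_const
  obtain ⟨σ₀, hσ₀, h1⟩ := h (fun _ => 1) (fun _ => θ₀) (fun _ => 0) hc1 hcθ hc0
    (fun _ => one_pos) (fun _ => hθ₀pos)
  obtain ⟨σ₁, hσ₁, -, hL⟩ := homogeneous_lln_identified hθ₀pos
  obtain ⟨σ, hσpos, hσlt0, hσlt1, hσhalf⟩ : ∃ σ : ℝ, 0 < σ ∧ σ < σ₀ ∧ σ < σ₁ ∧ σ < 2⁻¹ := by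
    refine ⟨min (min σ₀ σ₁) 2⁻¹ / 2, by positivity, ?_, ?_, ?_⟩ <;>
      linarith [min_le_left (min σ₀ σ₁) (2⁻¹ : ℝ), min_le_right (min σ₀ σ₁) (2⁻¹ : ℝ),
        min_le_left σ₀ σ₁, min_le_right σ₀ σ₁, lt_min (lt_min hσ₀ hσ₁) (show (0 : ℝ) < 2⁻¹ by norm_num)]
  have hσhalf' : σ ≤ 1 / 2 := by rw [one_div]; exact hσhalf.le
  let Φ : (N : ℕ) → HardSphereFlow (Torus.geometry (Fin 3)) (hsDiameter σ N) (N + 1) := fun N =>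
    Classical.choice (HardSphereFlow.nonempty_torus_holds (d := Fin 3) (hsDiameter_pos hσpos N)
      (lt_of_le_of_lt (hsDiameter_le hσpos.le N) hσhalf) (N + 1))
  have hT := hL σ hσpos hσlt1 Φ
  have hsol := constState_isSolution σ 1 hθ₀pos
  have hsmooth : Literature.Analysis.FunctionSpaces.Torus.IsSmoothSpaceTimeOn Set.univ
      (fun (s : ℝ) (_ : T3) => psi s) := by
    show ContDiffOn ℝ _ (fun p : ℝ × EuclideanSpace ℝ (Fin 3) => psi p.1) _
    exact (psi_contDiff.comp contDiff_fst).contDiffOn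
  obtain ⟨r₀, hr₀, N₀, h4⟩ := h1 σ hσpos hσlt0 1 (fun _ _ => 1) (fun _ _ => θ₀) (fun _ _ => 0) hsol Φ hT
    one_pos 1 one_pos (fun s _ => psi s) hsmooth (fun s _ => psi_nonneg s)
    ⟨1 / 2, by norm_num, fun s hs _ => psi_eq_zero hs⟩ (1 / 2) (1 / 2) (by norm_num) (by norm_num)
  have hε := hsDiameter_pos hσpos N₀
  set r : ℝ := min (r₀ / 2) (hsDiameter σ N₀ / 4) with hr
  have hrpos : 0 < r := by positivity
  have hrlt : r < r₀ := lt_of_le_of_lt (min_le_left _ _) (by linarith)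
  have h2r : 2 * r < hsDiameter σ N₀ := by
    have := min_le_right (r₀ / 2) (hsDiameter σ N₀ / 4); linarith
  have h5 := h4 r hrpos hrlt N₀ le_rfl
  change localGibbsLaw σ (fun _ => 1) (fun _ => 0) (fun _ => θ₀) N₀ (Φ N₀)
      {z | entropyFunctional σ r 1 (fun s _ => psi s) (Φ N₀) z +
        ∫ x : T3, Hs σ ((fun _ _ => (1 : ℝ)) 0 x) ((fun _ _ => θ₀) 0 x) *
          (fun (s : ℝ) (_ : T3) => psi s) 0 x < -(1 / 2)} ≤ ENNReal.ofReal (1 / 2) at h5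
  haveI : IsProbabilityMeasure (localGibbsLaw σ (fun _ => 1) (fun _ => 0) (fun _ => θ₀) N₀ (Φ N₀)) :=
    isProbabilityMeasure_localGibbsLaw hc1 hcθ hc0 (fun _ => one_pos) (fun _ => hθ₀pos) hσhalf' N₀ (Φ N₀)
  have hHs : Hs σ 1 θ₀ = hsExcessFreeEnergy (1 * σ ^ 3) - 3 := by
    unfold Hs
    rw [if_pos ⟨one_pos, hθ₀pos⟩, Real.log_one, hθ₀, Real.log_exp]
    ring
  have hinit : (∫ x : T3, Hs σ ((fun _ _ => (1 : ℝ)) 0 x) ((fun _ _ => θ₀) 0 x) *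
      (fun (s : ℝ) (_ : T3) => psi s) 0 x) = hsExcessFreeEnergy (1 * σ ^ 3) - 3 := by
    show (∫ _ : T3, Hs σ 1 θ₀ * psi 0) = _
    rw [integral_const, psi_zero, mul_one, hHs]
    simp
  have hf2 : hsExcessFreeEnergy (1 * σ ^ 3) ≤ 2 := by
    rw [one_mul]; exact hsExcessFreeEnergy_le_two hσpos.le hσhalf'
  have hgood : (Φ N₀).good ⊆ {z | entropyFunctional σ r 1 (fun s _ => psi s) (Φ N₀) z +
        ∫ x : T3, Hs σ ((fun _ _ => (1 : ℝ)) 0 x) ((fun _ _ => θ₀) 0 x) *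
          (fun (s : ℝ) (_ : T3) => psi s) 0 x < -(1 / 2)} := by
    intro z hz
    rw [Set.mem_setOf_eq, entropyFunctional_eq_zero_of_sep hrpos h2r (Φ N₀) 1 _ hz, hinit]
    linarith
  have hg1 : localGibbsLaw σ (fun _ => 1) (fun _ => 0) (fun _ => θ₀) N₀ (Φ N₀) (Φ N₀).good = 1 := by
    have hac : localGibbsLaw σ (fun _ => 1) (fun _ => 0) (fun _ => θ₀) N₀ (Φ N₀) ≪
        liouville (Torus.geometry (Fin 3)) (N₀ + 1) (hsDiameter σ N₀) :=
      withDensity_absolutelyContinuous _ _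
    have h0 : localGibbsLaw σ (fun _ => 1) (fun _ => 0) (fun _ => θ₀) N₀ (Φ N₀) ((Φ N₀).good)ᶜ = 0 :=
      hac (Φ N₀).measure_compl_good
    have := prob_add_prob_compl (μ := localGibbsLaw σ (fun _ => 1) (fun _ => 0) (fun _ => θ₀) N₀ (Φ N₀))
      (Φ N₀).measurableSet_good
    rwa [h0, add_zero] at this
  have h6 : (1 : ℝ≥0∞) ≤ ENNReal.ofReal (1 / 2) := by
    rw [← hg1]; exact (measure_mono hgood).trans h5
  have h7 : (1 : ℝ≥0∞).toReal ≤ 1 / 2 := ENNReal.toReal_le_of_le_ofReal (by norm_num) h6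
  norm_num at h7

end Summit.AtomisticToContinuum.HydrodynamicLimit.Theorems.LocalSecondLawNegative

end
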